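import Summits.AtomisticToContinuum.FouriersLaw.Theorems.VanishingNoiseTransferNoisyFourierAbelTimeProfileAux2
import Summits.AtomisticToContinuum.FouriersLaw.Theorems.VanishingNoiseTransferNoisyFourierAbelTimeProfileAux3
import Summits.AtomisticToContinuum.FouriersLaw.Theorems.VanishingNoiseTransferNoisyFourierAbelTimeProfileAux4
import Summits.AtomisticToContinuum.FouriersLaw.Theorems.VanishingNoiseTransferNoisyFourierAbelTransfer
import Summits.AtomisticToContinuum.FouriersLaw.Theorems.LatticeLandauDampingAbelThermodynamicLimitFixedFrequencyMatchingAutocorrBound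

/-!
# The time-profile representation of the Abel–Green–Kubo pairing of the velocity-flip pinned chain
(`--supports stmt-AtomisticToContinuum-11977` helper file, crux `VanishingNoiseTransfer.NoisyFourier`, line
`abel-storage-decay`, registered stub `stub_timeProfileMatching`, its fixed-`L` half T1; worker T1 of lead c6,
final part — proves the registered helper `helper_abelTimeProfileRepresentation`; parts: …AbelTimeProfileAux1
(invariance passes to the jump perturbation), …Aux2 (`exists_flipSemigroup_gibbs`), …Aux3 (mild corrector = Neumann
series), …Aux4 (invariant-kernel autocorrelations, Fubini, classical representative of the mild corrector))

Setting: the pinned anharmonic chain `𝐏 = pinnedChain ω₂ lam β γ` (all parameters `> 0`) with velocity flips at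
rate `ε > 0` and both Langevin baths at `T > 0`; Gibbs measure `μ_T = 𝐏.gibbsMeasure L T`, flip generator
`L_ε = 𝐏.flipGenerator L T T ε`, total current `J_L = Σ_i j_i`, CLASSICAL Abel correctors `u ∈ C² ∩ L²(μ_T)` with
`L_ε u = s u − J_L` pointwise (`s > 0`), and the Abel–Green–Kubo pairing `σ_L(s) = ∫ J_L u dμ_T`. The registered
stub `stub_timeProfileMatching` re-routes the fixed-`s` thermodynamic limit of `σ_L(s)/(L − 1)` through the time
domain; its fixed-`L` half is proved here (`abelTimeProfileRepresentation`, registered form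
`helper_abelTimeProfileRepresentation`): with `V_t` the flip semigroup (`exists_flipSemigroup_gibbs`, part 2) and the
TIME PROFILE `c_L(t) := ⟨J_L, V_t J_L⟩_{μ_T} = ∫ J_L(z) (∫ J_L dV_t(z, ·)) dμ_T(z)`,

  `σ_L(s) = ∫₀^∞ e^{-st} c_L(t) dt`,  `t ↦ c_L(t)` measurable,  `|c_L(t)| ≤ ‖J_L‖²_{L²(μ_T)} ≤ B (L − 1)`.

Proof. (i) `|⟨f, V_t f⟩| ≤ ‖f‖²` for `f ∈ L²(μ_T)` from the invariance `μ_T V_t = μ_T` (AM–GM, Jensen a.e., no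
semigroup property needed: `integrable_mul_integral_of_invariant`, part 4a), and `‖J_L‖² ≤ 3ML ≤ 6M(L − 1)` by the orthogonality
of distant bond currents (`pinnedChain_integral_sq_totalCurrent_le`, twin line of `LatticeLandauDamping`); measurability
in `t` from the joint measurability of `V`. (ii) Every classical corrector `u` has the same pairing as the smooth
representative `v` of the MILD corrector `u⋆` (`resolvent_identity` at `s = s'`; `exists_classical_aeEq_mild` re-runs
`stub_abelCorrectorExists` keeping `v = u⋆` a.e.). (iii) `u⋆(z) = s⁻¹ Σ_n p_n ∫ J dW_n(z)` (part 3,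
`mildCorrector_hasSum_neumann`) `= s⁻¹ ∫ Exp_s(dt) (V_t J)(z)` at EVERY `z` (Laplace–Neumann identity (7) of part 2,
`integral_expMeasure_integral_eq_of_hasSum`). (iv) Fubini over `μ_T ⊗ Exp_s` (`integral_mul_laplace`, part 4a).

No definitions; axioms `propext`, `Classical.choice`, `Quot.sound` only. References: Bernardin–Olla 2011 §§2.1, 5;
Ethier–Kurtz 1986 Ch. 1 §7, Ch. 4 §10; folklore (Laplace transform of a contraction semigroup at equilibrium).
-/

noncomputable section

open MeasureTheory ProbabilityTheory Filter Topology Set Function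
open scoped NNReal ENNReal BigOperators ContDiff
open Literature.MathematicalPhysics.KineticTheory.HeatConduction
open Literature.Probability.Process OscillatorChain
open Summit.AtomisticToContinuum.FouriersLaw.Theorems.VanishingNoiseBound (exists_flipSemigroup_gibbs)
open Summit.AtomisticToContinuum.FouriersLaw.Theorems.AbelThermodynamicLimit.SeriesLawAtEveryLaplaceFrequency
  (pinnedChain_integral_sq_totalCurrent_le)
open Summit.AtomisticToContinuum.FouriersLaw.Theorems.AbelThermodynamicLimit.LoomisCompactHorizonWitness
  (pinnedChain_integral_sq_bondCurrent_gibbsMeasure_le)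

namespace Summit.AtomisticToContinuum.FouriersLaw.Cruxes.NoisyFourier.AbelKapitzaEvenCorrector

namespace AbelTimeProfile


/-! ## The velocity-flip pinned chain -/

section Chain

variable {ω₂ lam β γ : ℝ} {L : ℕ}

/-- **The time-profile representation for a GIVEN family of equilibrium flip semigroups** (the reusable form of T1:
the profile `c` is shared with the thermodynamic-limit half T2 of `stub_timeProfileMatching`). Let, for every `L ≥ 1`,
`V_L` be a measurable family of Markov kernels on the `L`-particle phase space leaving `μ_T = gibbsMeasure L T` invariant
and satisfying the Laplace–Neumann identity (7) of `exists_flipSemigroup_gibbs` (e.g. THE flip semigroups delivered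
there), and let `c L t = ∫ J_L(z) (∫ J_L dV_L t⁺ (z, ·)) dμ_T(z)` for `L ≥ 1` (`c 0` any measurable function). Then
`c L` is measurable, `|c L t| ≤ 6M(L − 1)` for `L ≥ 2` (`M` the `L`-uniform bond-current second-moment bound), and for
every `L ≥ 2`, `s > 0` and every classical Abel corrector `u` at `s`: `∫ J_L u dμ_T = ∫₀^∞ e^{-st} c L t dt`.
[cite: BernardinOlla2011, §5] -/
theorem abelTimeProfile_of_family (hω : 0 < ω₂) (hl : 0 < lam) (hβ : 0 < β) (hγ : 0 < γ) {T : ℝ} (hT : 0 < T)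
    {ε : ℝ} (hε : 0 < ε)
    (V : (L : ℕ) → 0 < L → ℝ≥0 → Kernel (PhaseSpace L) (PhaseSpace L))
    (hVM : ∀ (L : ℕ) (hL : 0 < L) (t : ℝ≥0), IsMarkovKernel (V L hL t))
    (hVmeas : ∀ (L : ℕ) (hL : 0 < L), Measurable fun p : ℝ≥0 × PhaseSpace L => V L hL p.1 p.2)
    (hVinv : ∀ (L : ℕ) (hL : 0 < L) (t : ℝ≥0),
      ((pinnedChain ω₂ lam β γ).gibbsMeasure L T).bind (V L hL t) = (pinnedChain ω₂ lam β γ).gibbsMeasure L T)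
    (hVlap : ∀ (L : ℕ) (hL : 0 < L) (a : ℝ), 0 < a → ∀ W : ℕ → Kernel (PhaseSpace L) (PhaseSpace L),
      W 0 = (pinnedChainSemigroup hω hl.le hβ.le hγ.le hL hT.le hT.le).resolventKernel (a + L * ε) →
      (∀ n, W (n + 1) = (pinnedChainSemigroup hω hl.le hβ.le hγ.le hL hT.le hT.le).resolventKernel
        (a + L * ε) ∘ₖ (flipKernel L ∘ₖ W n)) →
      ∀ φ : PhaseSpace L → ℝ≥0∞, Measurable φ → ∀ z : PhaseSpace L,
        ∫⁻ t, ∫⁻ y, φ y ∂(V L hL t.toNNReal z) ∂(expMeasure a) =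
          ∑' n, ENNReal.ofReal (a / (a + L * ε) * (L * ε / (a + L * ε)) ^ n) * ∫⁻ y, φ y ∂(W n z))
    (c : ℕ → ℝ → ℝ)
    (hc : ∀ (L : ℕ) (hL : 0 < L) (t : ℝ), c L t =
      ∫ z, (∑ i : Fin L, (pinnedChain ω₂ lam β γ).bondCurrent L i z) *
        ∫ y, (∑ i : Fin L, (pinnedChain ω₂ lam β γ).bondCurrent L i y) ∂(V L hL t.toNNReal z)
        ∂((pinnedChain ω₂ lam β γ).gibbsMeasure L T))
    (hc0 : Measurable (c 0)) :
    ∃ B : ℝ, (∀ L : ℕ, Measurable (c L)) ∧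
      (∀ L : ℕ, 2 ≤ L → ∀ t : ℝ, 0 < t → |c L t| ≤ B * ((L : ℝ) - 1)) ∧
      ∀ (L : ℕ), 2 ≤ L → ∀ s : ℝ, 0 < s → ∀ u : PhaseSpace L → ℝ,
        (ContDiff ℝ 2 u ∧ MemLp u 2 ((pinnedChain ω₂ lam β γ).gibbsMeasure L T) ∧
          ∀ x, (pinnedChain ω₂ lam β γ).flipGenerator L T T ε u x =
            s * u x - ∑ i : Fin L, (pinnedChain ω₂ lam β γ).bondCurrent L i x) →
        ∫ x, (∑ i : Fin L, (pinnedChain ω₂ lam β γ).bondCurrent L i x) * u x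
            ∂((pinnedChain ω₂ lam β γ).gibbsMeasure L T) =
          ∫ t in Ioi (0 : ℝ), Real.exp (-(s * t)) * c L t := by
  set P := pinnedChain ω₂ lam β γ with hP
  -- the static bound `‖J_L‖² ≤ 3ML`
  obtain ⟨M, hM⟩ := pinnedChain_integral_sq_bondCurrent_gibbsMeasure_le (γ := γ) hω hl hβ hT
  have hM0 : 0 ≤ M := (integral_nonneg fun z => sq_nonneg _).trans (hM 1 0)
  -- data shared by all clauses
  have hJc : ∀ L : ℕ, Continuous fun x : PhaseSpace L => ∑ i : Fin L, P.bondCurrent L i x := fun L =>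
    continuous_finsetSum _ fun i _ => pinnedChain_continuous_bondCurrent ω₂ lam β γ L i
  haveI hμ : ∀ L : ℕ, IsProbabilityMeasure (P.gibbsMeasure L T) := fun L =>
    pinnedChain_isProbabilityMeasure_gibbsMeasure hω hl.le hβ.le γ L hT
  refine ⟨6 * M, fun L => ?_, fun L hL t _ => ?_, fun L hL s hs u hu => ?_⟩
  · -- measurability of the profile
    by_cases hL : 0 < L
    · rw [funext (hc L hL)]
      exact measurable_autocorr (V L hL) (hVmeas L hL) (P.gibbsMeasure L T) (hJc L).stronglyMeasurable
    · obtain rfl : L = 0 := Nat.eq_zero_of_not_pos hL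
      exact hc0
  · -- the bound `|c_L(t)| ≤ ‖J_L‖² ≤ 3ML ≤ 6M(L - 1)`
    have hL0 : 0 < L := by omega
    haveI := hVM L hL0
    rw [hc L hL0 t]
    have h := integrable_mul_integral_of_invariant (V L hL0 t.toNNReal) (hVinv L hL0 _)
      (hJc L).stronglyMeasurable (AbelTransfer.memLp_totalCurrent hω hl.le hβ.le γ L hT)
    have hsq := pinnedChain_integral_sq_totalCurrent_le hω hl.le hβ hγ hL0 hT (hM L)
    have hL2 : (2 : ℝ) ≤ L := by exact_mod_cast hL
    calc |∫ z, (∑ i : Fin L, P.bondCurrent L i z) *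
            ∫ y, (∑ i : Fin L, P.bondCurrent L i y) ∂(V L hL0 t.toNNReal z) ∂(P.gibbsMeasure L T)|
        ≤ ∫ z, |(∑ i : Fin L, P.bondCurrent L i z) *
            ∫ y, (∑ i : Fin L, P.bondCurrent L i y) ∂(V L hL0 t.toNNReal z)| ∂(P.gibbsMeasure L T) :=
          abs_integral_le_integral_abs
      _ ≤ ∫ z, (∑ i : Fin L, P.bondCurrent L i z) ^ 2 ∂(P.gibbsMeasure L T) := h.2
      _ ≤ 3 * M * L := hsq
      _ ≤ 6 * M * ((L : ℝ) - 1) := by nlinarith [mul_nonneg hM0 (sub_nonneg.2 hL2)]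
  · -- the representation
    obtain ⟨huC, hu2, hpde⟩ := hu
    have hL0 : 0 < L := by omega
    have hL1 : 1 < L := by omega
    haveI := hVM L hL0
    set μ := P.gibbsMeasure L T with hμdef
    set J : PhaseSpace L → ℝ := fun x => ∑ i : Fin L, P.bondCurrent L i x with hJ
    have hJ2 : MemLp J 2 μ := AbelTransfer.memLp_totalCurrent hω hl.le hβ.le γ L hT
    have hJodd : ∀ x : PhaseSpace L, J (x.1, -x.2) = -J x := fun x => AbelTransfer.totalCurrent_neg_momentum P x
    -- (ii) the mild corrector, its classical representative, and the independence of the pairing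
    obtain ⟨um, v, humm, humb, hmild, hvC, hv2, hvpde, hae⟩ :=
      exists_classical_aeEq_mild hω hl hβ hγ hL hT hε hs
    have hpair : ∫ x, J x * u x ∂μ = ∫ x, J x * v x ∂μ := by
      have h := AbelTransfer.resolvent_identity hω hl hβ hγ hT ε hJ2 hJodd huC hu2 hpde hvC hv2 hvpde
      rw [sub_self, zero_mul] at h
      linarith
    have haeμ : ∀ᵐ x ∂μ, um x = v x := (P.gibbsMeasure_absolutelyContinuous L T).ae_le hae
    have hpair' : ∫ x, J x * v x ∂μ = ∫ x, J x * um x ∂μ := by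
      refine integral_congr_ae ?_
      filter_upwards [haeμ] with x hx
      rw [hx]
    -- (iii) the Neumann kernels at `a = s` and the pointwise Laplace representation of `u⋆`
    set Rk := (pinnedChainSemigroup hω hl.le hβ.le hγ.le hL0 hT.le hT.le).resolventKernel (s + L * ε) with hRk
    obtain ⟨W, hW0, hWsucc⟩ : ∃ W : ℕ → Kernel (PhaseSpace L) (PhaseSpace L),
        W 0 = Rk ∧ ∀ n, W (n + 1) = Rk ∘ₖ (flipKernel L ∘ₖ W n) :=
      ⟨fun n => Nat.rec Rk (fun _ w => Rk ∘ₖ (flipKernel L ∘ₖ w)) n, rfl, fun n => rfl⟩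
    have hD : ∀ z, ∫ t, (∫ y, J y ∂(V L hL0 t.toNNReal z)) ∂(expMeasure s) = s * um z := by
      intro z
      have hC := mildCorrector_hasSum_neumann hω hl hβ hγ hL1 hT hε hs humm humb hmild W hW0 hWsucc z
      exact integral_expMeasure_integral_eq_of_hasSum (V L hL0) (hVmeas L hL0) s
        (fun n => s / (s + L * ε) * (L * ε / (s + L * ε)) ^ n) (fun n => by positivity)
        (fun n => W n z) z (fun φ hφ => hVlap L hL0 s hs W hW0 hWsucc φ hφ z) (hJc L).measurable hC.1 hC.2
    -- (iv) Fubini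
    have hE := integral_mul_laplace (V L hL0) (hVmeas L hL0) (hVinv L hL0) (f := J)
      (hJc L).stronglyMeasurable hJ2 hs
    simp_rw [hc L hL0]
    calc ∫ x, J x * u x ∂μ = ∫ x, J x * um x ∂μ := hpair.trans hpair'
      _ = ∫ z, J z * (s⁻¹ * ∫ t, (∫ y, J y ∂(V L hL0 t.toNNReal z)) ∂(expMeasure s)) ∂μ := by
          refine integral_congr_ae (Eventually.of_forall fun z => ?_)
          simp only [hD z]
          rw [← mul_assoc s⁻¹, inv_mul_cancel₀ hs.ne', one_mul]
      _ = s⁻¹ * ∫ z, J z * (∫ t, (∫ y, J y ∂(V L hL0 t.toNNReal z)) ∂(expMeasure s)) ∂μ := by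
          rw [← integral_const_mul]
          refine integral_congr_ae (Eventually.of_forall fun z => ?_)
          ring
      _ = s⁻¹ * ∫ t in Ioi (0:ℝ), s * Real.exp (-(s * t)) *
            ∫ z, J z * (∫ y, J y ∂(V L hL0 t.toNNReal z)) ∂μ := by rw [hE]
      _ = ∫ t in Ioi (0:ℝ), Real.exp (-(s * t)) *
            ∫ z, J z * (∫ y, J y ∂(V L hL0 t.toNNReal z)) ∂μ := by
          rw [← integral_const_mul]
          refine integral_congr_ae (Eventually.of_forall fun t => ?_)
          dsimp only
          rw [← mul_assoc, ← mul_assoc, inv_mul_cancel₀ hs.ne', one_mul]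

/-- **The time-profile representation of the Abel–Green–Kubo pairing** (T1 of `stub_timeProfileMatching`). For the
velocity-flip pinned chain (all parameters `> 0`, both baths at `T`): there are `B` and, for every `L`, a measurable
time profile `c_L` — the equilibrium autocorrelation `c_L(t) = ∫ J_L(z) (∫ J_L dV_t(z,·)) dμ_T(z)` of the total
current under the flip semigroup `V` of `exists_flipSemigroup_gibbs` (`c_0 ≡ 0`) — with `|c_L(t)| ≤ B(L − 1)`
(`L ≥ 2`, `t > 0`) and, for every `L ≥ 2`, `s > 0` and every CLASSICAL Abel corrector `u` at `s`,
`∫ J_L u dμ_T = ∫₀^∞ e^{-st} c_L(t) dt` (`abelTimeProfile_of_family` for the chosen semigroups).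
[cite: BernardinOlla2011, §5] -/
theorem abelTimeProfileRepresentation (hω : 0 < ω₂) (hl : 0 < lam) (hβ : 0 < β) (hγ : 0 < γ) {T : ℝ} (hT : 0 < T)
    {ε : ℝ} (hε : 0 < ε) :
    ∃ B : ℝ, ∃ c : ℕ → ℝ → ℝ, (∀ L : ℕ, Measurable (c L)) ∧
      (∀ L : ℕ, 2 ≤ L → ∀ t : ℝ, 0 < t → |c L t| ≤ B * ((L : ℝ) - 1)) ∧
      ∀ (L : ℕ), 2 ≤ L → ∀ s : ℝ, 0 < s → ∀ u : PhaseSpace L → ℝ,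
        (ContDiff ℝ 2 u ∧ MemLp u 2 ((pinnedChain ω₂ lam β γ).gibbsMeasure L T) ∧
          ∀ x, (pinnedChain ω₂ lam β γ).flipGenerator L T T ε u x =
            s * u x - ∑ i : Fin L, (pinnedChain ω₂ lam β γ).bondCurrent L i x) →
        ∫ x, (∑ i : Fin L, (pinnedChain ω₂ lam β γ).bondCurrent L i x) * u x
            ∂((pinnedChain ω₂ lam β γ).gibbsMeasure L T) =
          ∫ t in Ioi (0 : ℝ), Real.exp (-(s * t)) * c L t := by
  set P := pinnedChain ω₂ lam β γ with hP
  -- the flip semigroups at equilibrium, one for every `L ≥ 1`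
  have hV : ∀ (L : ℕ) (hL : 0 < L), ∃ V : ℝ≥0 → Kernel (PhaseSpace L) (PhaseSpace L),
      (∀ t, IsMarkovKernel (V t)) ∧ (Measurable fun p : ℝ≥0 × PhaseSpace L => V p.1 p.2) ∧
      (∀ t, (P.gibbsMeasure L T).bind (V t) = P.gibbsMeasure L T) ∧
      (∀ a : ℝ, 0 < a → ∀ W : ℕ → Kernel (PhaseSpace L) (PhaseSpace L),
        W 0 = (pinnedChainSemigroup hω hl.le hβ.le hγ.le hL hT.le hT.le).resolventKernel (a + L * ε) →
        (∀ n, W (n + 1) = (pinnedChainSemigroup hω hl.le hβ.le hγ.le hL hT.le hT.le).resolventKernel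
          (a + L * ε) ∘ₖ (flipKernel L ∘ₖ W n)) →
        ∀ φ : PhaseSpace L → ℝ≥0∞, Measurable φ → ∀ z : PhaseSpace L,
          ∫⁻ t, ∫⁻ y, φ y ∂(V t.toNNReal z) ∂(expMeasure a) =
            ∑' n, ENNReal.ofReal (a / (a + L * ε) * (L * ε / (a + L * ε)) ^ n) * ∫⁻ y, φ y ∂(W n z)) := by
    intro L hL
    obtain ⟨V, h1, -, -, h4, -, -, h7, h8⟩ := exists_flipSemigroup_gibbs hω hl.le hβ.le hγ.le hL hT hε
    exact ⟨V, h1, h4, h7, h8⟩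
  choose V hVM hVmeas hVinv hVlap using hV
  obtain ⟨B, hB⟩ := abelTimeProfile_of_family hω hl hβ hγ hT hε V hVM hVmeas hVinv hVlap
    (fun L t => if hL : 0 < L then ∫ z, (∑ i : Fin L, P.bondCurrent L i z) *
      ∫ y, (∑ i : Fin L, P.bondCurrent L i y) ∂(V L hL t.toNNReal z) ∂(P.gibbsMeasure L T) else 0)
    (fun L hL t => by simp only [dif_pos hL, hP]) (by simpa only [lt_self_iff_false, dif_neg, not_false_eq_true]
      using measurable_const)
  exact ⟨B, _, hB⟩

/-- **Registered helper `helper_abelTimeProfileRepresentation`** of stmt-AtomisticToContinuum-11977 (worker T1 of lead c6;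
the fixed-`L` half T1 of the registered stub `stub_timeProfileMatching`, line `abel-storage-decay`):
`abelTimeProfileRepresentation`, fully quantified and notation-free. [cite: BernardinOlla2011, §5] -/
theorem helper_abelTimeProfileRepresentation : ∀ (ω₂ lam β γ T ε : ℝ), 0 < ω₂ → 0 < lam → 0 < β → 0 < γ → 0 < T → 0 < ε → ∃ B : ℝ, ∃ c : ℕ → ℝ → ℝ, (∀ L : ℕ, Measurable (c L)) ∧ (∀ L : ℕ, 2 ≤ L → ∀ t : ℝ, 0 < t → |c L t| ≤ B * ((L : ℝ) - 1)) ∧ ∀ (L : ℕ), 2 ≤ L → ∀ s : ℝ, 0 < s → ∀ u : Literature.MathematicalPhysics.KineticTheory.HeatConduction.PhaseSpace L → ℝ, (ContDiff ℝ 2 u ∧ MeasureTheory.MemLp u 2 ((Literature.MathematicalPhysics.KineticTheory.HeatConduction.pinnedChain ω₂ lam β γ).gibbsMeasure L T) ∧ ∀ x, (Literature.MathematicalPhysics.KineticTheory.HeatConduction.pinnedChain ω₂ lam β γ).flipGenerator L T T ε u x = s * u x - ∑ i : Fin L, (Literature.MathematicalPhysics.KineticTheory.HeatConduction.pinnedChain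 ω₂ lam β γ).bondCurrent L i x) → MeasureTheory.integral ((Literature.MathematicalPhysics.KineticTheory.HeatConduction.pinnedChain ω₂ lam β γ).gibbsMeasure L T) (fun x => (∑ i : Fin L, (Literature.MathematicalPhysics.KineticTheory.HeatConduction.pinnedChain ω₂ lam β γ).bondCurrent L i x) * u x) = MeasureTheory.integral (MeasureTheory.volume.restrict (Set.Ioi (0 : ℝ))) (fun t => Real.exp (-(s * t)) * c L t) :=
  fun _ _ _ _ _ _ hω hl hβ hγ hT hε => abelTimeProfileRepresentation hω hl hβ hγ hT hε

end Chain

end AbelTimeProfile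

end Summit.AtomisticToContinuum.FouriersLaw.Cruxes.NoisyFourier.AbelKapitzaEvenCorrector

end
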